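import Mathlib
import Literature.Barriers.ValiantsHypothesis.AlgebraicNaturalProofs
import Literature.Computability.AlgebraicComplexity.ArithCircuitProofs
import Summits.ValiantsHypothesis.ValiantsHypothesis.Theorems.BarrierLeverPartitionMinorsHitByVPCellDoorPotentials

/-!
# Route BarrierLever — item `PartitionMinorsHitByVP` (stmt-ValiantsHypothesis-19717):
# the CELL door (power diagrams on both sides) and the lexicographic flattening of hierarchies

Helper file (`--supports stmt-ValiantsHypothesis-19717`; cell valiant-natproofs, rung V4, 𝒟-side,
prover seat val-np-p6 gen 2). Definition-free. Closes NO item.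

* **`partitionMinor_hit_of_cells`** (THE CELL DOOR = power diagrams). Rows are partitioned by the
  STRICT ARGMAX of `m` affine functionals `ρ_t(i) = k_t + Σ_{a ∈ u_i} λ_{t,a}`, columns
  independently by the strict argmax of `κ_t(j) = k'_t + Σ_{c ∈ w_j} μ_{t,c}` (the cells of two
  max-plus affine arrangements on the cube, one on each side), row cell `t` faces column cell `t`;
  with the potentials `Φ = max_t ρ_t`, `Ψ = max_t κ_t` the tight matrix of the potential door
  (`…StrataDoor.partitionMinor_hit_of_potentials`) is block-DIAGONAL, so nonsingular cell matrices
  suffice (`…StrataDoor.det_ne_zero_of_levels`); size `≤ Σ_t L(F t) + m(2h+2)`, degree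
  `≤ max_t deg(F t)`. The m-strata door p448281 is the case `ρ_t = K_t + 2t·λ` (parallel
  functionals: cells = intervals of one functional, envelope `…StrataDoor.envelope_lt`); here the
  functionals of different cells are unrelated, on each side separately.
* **`partitionMinor_hit_of_cells_perm`** — the same in the item's coordinates `u w : Fin r → …` with
  row cells `lr`, column cells `lc` and a permutation `e` of `Fin r` carrying row cell `t` onto column
  cell `t` (`lc (e i) = lr i`).
* **`lex_strict`** — LEXICOGRAPHIC FLATTENING: a strict-argmax structure with `m₁` pieces (outer)
  and, on each outer piece `t₁`, a strict-argmax structure with `m₂` pieces (inner, its functionals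
  depending on `t₁`) combine into ONE strict-argmax structure with `m₁·m₂` pieces
  `(2M+1)·outer_{t₁} + inner_{t₁,t₂}` for `M` bounding the inner scores. Consequently a HIERARCHY of
  threshold splits of any fixed depth (inner thresholds depending on the outer stratum — not
  expressible by one threshold pair) is a single application of the cell door whose cells are the
  LEAVES: no inductive certificate type is needed, and the size budget `(h+h)^b` still counts
  leaves, not depth (this settles the two points left open in `…StrataLeaves` / HANDOFF § val-np-p6
  g0: (a) block products of stratified layouts with functionals varying across strata, (b) the
  hierarchy version of the conditional door).

WHAT THIS IS NOT: which layouts admit poly(h)-cell certificates with certified cells is OPEN (the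
content of item 19717 on the random-like middle band `r ≈ 2^{h/2}`); nothing here bears on TT /
item 19616 / 19761, on crux 14610 or on VP vs VNP.
-/

set_option linter.dupNamespace false

namespace Summit.ValiantsHypothesis.ValiantsHypothesis.Theorems.BarrierLever.StrataDoor

open Finset
open Literature.Barriers.ValiantsHypothesis Literature.Computability.AlgebraicComplexity

/-! ## 1. The cell door (power diagrams on both sides) -/

/-- **The cell door.** Rows and columns indexed by `ι`; row `i` lies in row cell `lv i < m`, the
STRICT argmax over `t < m` of the row scores `kr t + Σ_{a ∈ u i} lam t a`; column `j` lies in column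
cell `lv j`, the strict argmax of the column scores `kc t + Σ_{c ∈ w j} mu t c` (row cell `t` faces
column cell `t`; the functionals of different cells are unrelated, and the row and column arrangements
are unrelated to each other). If every cell matrix (rows and columns of cell `t`, witness `F t`) is
nonsingular, some `f` of size `≤ Σ_{t<m} L(F t) + m(2h+2)` and degree `≤ max_t deg(F t)` has a
nonsingular layout matrix on `(u, w)`. -/
theorem partitionMinor_hit_of_cells {ι : Type*} [Fintype ι] [DecidableEq ι] (h m : ℕ)
    (u w : ι → Finset (Fin h)) (lam mu : ℕ → Fin h → ℤ) (kr kc : ℕ → ℤ) (lv : ι → ℕ)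
    (hlv : ∀ i, lv i < m)
    (hrow : ∀ i, ∀ t < m, t ≠ lv i →
      kr t + ∑ a ∈ u i, lam t a < kr (lv i) + ∑ a ∈ u i, lam (lv i) a)
    (hcol : ∀ j, ∀ t < m, t ≠ lv j →
      kc t + ∑ c ∈ w j, mu t c < kc (lv j) + ∑ c ∈ w j, mu (lv j) c)
    (F : ℕ → MvPolynomial (Fin (h + h)) ℂ)
    (hdet : ∀ t < m, (Matrix.of fun i j : {i // lv i = t} => MvPolynomial.coeff
        (∑ a ∈ u i.1, Finsupp.single (Fin.castAdd h a) 1 +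
          ∑ c ∈ w j.1, Finsupp.single (Fin.natAdd h c) 1) (F t)).det ≠ 0) :
    ∃ f : MvPolynomial (Fin (h + h)) ℂ,
      f.totalDegree ≤ (Finset.range m).sup (fun t => (F t).totalDegree) ∧
      complexity f ≤ ∑ t ∈ Finset.range m, complexity (F t) + m * (h + h + 2) ∧
      (Matrix.of fun i j : ι => MvPolynomial.coeff
        (∑ a ∈ u i, Finsupp.single (Fin.castAdd h a) 1 +
          ∑ c ∈ w j, Finsupp.single (Fin.natAdd h c) 1) f).det ≠ 0 := by
  classical
  set R : ℕ → ι → ℤ := fun t i => kr t + ∑ a ∈ u i, lam t a with hR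
  set Cx : ℕ → ι → ℤ := fun t j => kc t + ∑ c ∈ w j, mu t c with hCx
  -- potentials = the attained maxima
  refine partitionMinor_hit_of_potentials h m u w lam mu kr kc (fun i => R (lv i) i)
    (fun j => Cx (lv j) j) (fun t ht i j => ?_) F ?_
  · have h1 : R t i ≤ R (lv i) i := by
      rcases eq_or_ne t (lv i) with rfl | hne
      · exact le_rfl
      · exact (hrow i t ht hne).le
    have h2 : Cx t j ≤ Cx (lv j) j := by
      rcases eq_or_ne t (lv j) with rfl | hne
      · exact le_rfl
      · exact (hcol j t ht hne).le
    simp only [hR, hCx] at h1 h2 ⊢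
    linarith
  · -- the tight matrix is block diagonal with the cell matrices as blocks
    have htight : ∀ t < m, ∀ i j : ι,
        (kr t + ∑ a ∈ u i, lam t a + (kc t + ∑ c ∈ w j, mu t c) = R (lv i) i + Cx (lv j) j) ↔
          (t = lv i ∧ t = lv j) := by
      intro t ht i j
      constructor
      · intro hh
        have h1 : t = lv i := by
          by_contra hne
          have := hrow i t ht hne
          have h2 : Cx t j ≤ Cx (lv j) j := by
            rcases eq_or_ne t (lv j) with rfl | hne'
            · exact le_rfl
            · exact (hcol j t ht hne').le
          simp only [hR, hCx] at this h2 hh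
          linarith
        have h2 : t = lv j := by
          by_contra hne
          have := hcol j t ht hne
          have h3 : R t i ≤ R (lv i) i := by rw [h1]
          simp only [hR, hCx] at this h3 hh
          linarith
        exact ⟨h1, h2⟩
      · rintro ⟨rfl, h2⟩
        simp only [hR, hCx, ← h2]
    set N : Matrix ι ι ℂ := Matrix.of fun i j : ι => ∑ t ∈ Finset.range m,
        (if kr t + ∑ a ∈ u i, lam t a + (kc t + ∑ c ∈ w j, mu t c) = R (lv i) i + Cx (lv j) j then
          MvPolynomial.coeff (∑ a ∈ u i, Finsupp.single (Fin.castAdd h a) 1 +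
            ∑ c ∈ w j, Finsupp.single (Fin.natAdd h c) 1) (F t) else 0) with hN
    have hNentry : ∀ i j, N i j = if lv i = lv j then MvPolynomial.coeff
        (∑ a ∈ u i, Finsupp.single (Fin.castAdd h a) 1 +
          ∑ c ∈ w j, Finsupp.single (Fin.natAdd h c) 1) (F (lv i)) else 0 := by
      intro i j
      simp only [hN, Matrix.of_apply]
      by_cases hij : lv i = lv j
      · rw [if_pos hij, Finset.sum_eq_single (lv i)]
        · rw [if_pos ((htight _ (hlv i) i j).mpr ⟨rfl, hij⟩)]
        · intro t ht hne
          rw [if_neg (fun hh => hne ((htight t (Finset.mem_range.mp ht) i j).mp hh).1)]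
        · intro hh
          exact absurd (Finset.mem_range.mpr (hlv i)) hh
      · rw [if_neg hij]
        refine Finset.sum_eq_zero fun t ht => ?_
        rw [if_neg]
        intro hh
        obtain ⟨h1, h2⟩ := (htight t (Finset.mem_range.mp ht) i j).mp hh
        exact hij (h1.symm.trans h2)
    show N.det ≠ 0
    refine det_ne_zero_of_levels N lv (fun i j hij => by rw [hNentry, if_neg hij]) (fun t ht => ?_)
    obtain ⟨i₀, -, hi₀⟩ := Finset.mem_image.mp ht
    have htm : t < m := hi₀ ▸ hlv i₀
    have hblk : (Matrix.of fun i j : {i // lv i = t} => N i.1 j.1) =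
        Matrix.of fun i j : {i // lv i = t} => MvPolynomial.coeff
          (∑ a ∈ u i.1, Finsupp.single (Fin.castAdd h a) 1 +
            ∑ c ∈ w j.1, Finsupp.single (Fin.natAdd h c) 1) (F t) := by
      ext i j
      rw [Matrix.of_apply, Matrix.of_apply, hNentry, if_pos (i.2.trans j.2.symm), i.2]
    rw [hblk]
    exact hdet t htm

/-- **Cell door, `Fin r` form.** Row cells `lr`, column cells `lc`, a permutation `e` of `Fin r`
with `lc (e i) = lr i`; strict argmax on each side; per-cell witnesses `F t` nonsingular on the cells
(rows `{i // lr i = t}`, columns `e i'`) ⇒ one witness for the whole layout matrix of item 19717,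
size `≤ Σ_{t<m} L(F t) + m(2h+2)`, degree `≤ max deg (F t)`. -/
theorem partitionMinor_hit_of_cells_perm {h r : ℕ} (m : ℕ) (u w : Fin r → Finset (Fin h))
    (lam mu : ℕ → Fin h → ℤ) (kr kc : ℕ → ℤ) (lr lc : Fin r → ℕ) (e : Equiv.Perm (Fin r))
    (he : ∀ i, lc (e i) = lr i) (hlr : ∀ i, lr i < m)
    (hrow : ∀ i, ∀ t < m, t ≠ lr i →
      kr t + ∑ a ∈ u i, lam t a < kr (lr i) + ∑ a ∈ u i, lam (lr i) a)
    (hcol : ∀ j, ∀ t < m, t ≠ lc j →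
      kc t + ∑ c ∈ w j, mu t c < kc (lc j) + ∑ c ∈ w j, mu (lc j) c)
    (F : ℕ → MvPolynomial (Fin (h + h)) ℂ)
    (hdet : ∀ t < m, (Matrix.of fun i i' : {i // lr i = t} => MvPolynomial.coeff
        (∑ a ∈ u i.1, Finsupp.single (Fin.castAdd h a) 1 +
          ∑ c ∈ w (e i'.1), Finsupp.single (Fin.natAdd h c) 1) (F t)).det ≠ 0) :
    ∃ f : MvPolynomial (Fin (h + h)) ℂ,
      f.totalDegree ≤ (Finset.range m).sup (fun t => (F t).totalDegree) ∧
      complexity f ≤ ∑ t ∈ Finset.range m, complexity (F t) + m * (h + h + 2) ∧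
      (Matrix.of fun i j : Fin r => MvPolynomial.coeff
        (∑ a ∈ u i, Finsupp.single (Fin.castAdd h a) 1 +
          ∑ c ∈ w j, Finsupp.single (Fin.natAdd h c) 1) f).det ≠ 0 := by
  classical
  obtain ⟨f, hdeg, hsize, hne⟩ := partitionMinor_hit_of_cells h m u (fun i => w (e i)) lam mu kr kc
    lr hlr hrow (fun j t ht hne => by
      have := hcol (e j) t ht (by rw [he j]; exact hne)
      rwa [he j] at this) F hdet
  refine ⟨f, hdeg, hsize, ?_⟩
  set M : Matrix (Fin r) (Fin r) ℂ := Matrix.of fun i j : Fin r => MvPolynomial.coeff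
    (∑ a ∈ u i, Finsupp.single (Fin.castAdd h a) 1 + ∑ c ∈ w j, Finsupp.single (Fin.natAdd h c) 1) f
    with hM
  have hsub : (Matrix.of fun i j : Fin r => MvPolynomial.coeff
      (∑ a ∈ u i, Finsupp.single (Fin.castAdd h a) 1 +
        ∑ c ∈ w (e j), Finsupp.single (Fin.natAdd h c) 1) f) = M.submatrix id e := by
    ext i j
    rfl
  rw [hsub, Matrix.det_permute'] at hne
  intro h0
  exact hne (by rw [h0, mul_zero])

/-! ## 2. Lexicographic flattening of hierarchies -/

/-- **Lexicographic flattening.** Outer scores `ρ₁ t₁` (`t₁ < m₁`) with strict argmax `l₁`, inner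
scores `ρ₂ t₁ t₂` (`t₂ < m₂`, depending on the outer piece) with strict argmax `l₂` on the outer piece
`l₁`, all inner scores bounded by `|ρ₂ t₁ t₂| ≤ M`: then the combined scores
`(2M+1)·ρ₁ t₁ + ρ₂ t₁ t₂`, indexed by `t₁·m₂ + t₂ < m₁·m₂`, have the strict argmax `l₁·m₂ + l₂`.
This is how a two-level hierarchy of threshold splits (inner thresholds depending on the outer
stratum) becomes ONE instance of the cell door; iterating flattens any fixed depth. -/
theorem lex_strict (m₁ m₂ : ℕ) (ρ₁ : ℕ → ℤ) (ρ₂ : ℕ → ℕ → ℤ) (M : ℤ) (l₁ l₂ : ℕ)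
    (hl₁ : l₁ < m₁) (hl₂ : l₂ < m₂)
    (h₁ : ∀ t₁ < m₁, t₁ ≠ l₁ → ρ₁ t₁ < ρ₁ l₁)
    (h₂ : ∀ t₂ < m₂, t₂ ≠ l₂ → ρ₂ l₁ t₂ < ρ₂ l₁ l₂)
    (hM : ∀ t₁ < m₁, ∀ t₂ < m₂, |ρ₂ t₁ t₂| ≤ M) :
    l₁ * m₂ + l₂ < m₁ * m₂ ∧
    ∀ t < m₁ * m₂, t ≠ l₁ * m₂ + l₂ →
      (2 * M + 1) * ρ₁ (t / m₂) + ρ₂ (t / m₂) (t % m₂) <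
        (2 * M + 1) * ρ₁ ((l₁ * m₂ + l₂) / m₂) + ρ₂ ((l₁ * m₂ + l₂) / m₂) ((l₁ * m₂ + l₂) % m₂) := by
  have hm₂ : 0 < m₂ := by omega
  have hdiv : (l₁ * m₂ + l₂) / m₂ = l₁ := by
    rw [Nat.add_comm, Nat.add_mul_div_right _ _ hm₂, Nat.div_eq_of_lt hl₂, zero_add]
  have hmod : (l₁ * m₂ + l₂) % m₂ = l₂ := by
    rw [Nat.add_comm, Nat.add_mul_mod_self_right, Nat.mod_eq_of_lt hl₂]
  refine ⟨?_, fun t ht hne => ?_⟩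
  · calc l₁ * m₂ + l₂ < l₁ * m₂ + m₂ := by omega
      _ = (l₁ + 1) * m₂ := by ring
      _ ≤ m₁ * m₂ := Nat.mul_le_mul_right _ hl₁
  rw [hdiv, hmod]
  have ht₁ : t / m₂ < m₁ := by
    rw [Nat.div_lt_iff_lt_mul hm₂]; exact ht
  have ht₂ : t % m₂ < m₂ := Nat.mod_lt _ hm₂
  have hMnn : 0 ≤ M := (abs_nonneg _).trans (hM l₁ hl₁ l₂ hl₂)
  rcases eq_or_ne (t / m₂) l₁ with heq | hneq
  · -- same outer piece: the inner structure decides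
    rw [heq]
    have hne₂ : t % m₂ ≠ l₂ := by
      intro hh
      apply hne
      rw [← heq, ← hh]
      exact (Nat.div_add_mod' t m₂).symm
    have := h₂ (t % m₂) ht₂ hne₂
    linarith
  · -- different outer piece: the outer gap (≥ 1, scaled by 2M+1) beats the inner range (≤ 2M)
    have hgap : ρ₁ (t / m₂) + 1 ≤ ρ₁ l₁ := h₁ (t / m₂) ht₁ hneq
    have hb₁ := hM (t / m₂) ht₁ (t % m₂) ht₂
    have hb₂ := hM l₁ hl₁ l₂ hl₂
    have hb₁' := (abs_le.mp hb₁).2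
    have hb₂' := (abs_le.mp hb₂).1
    nlinarith

end Summit.ValiantsHypothesis.ValiantsHypothesis.Theorems.BarrierLever.StrataDoor
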